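import Literature.MathematicalPhysics.QuantumFieldTheory.Balaban1983to89.B5GaussSectC
import Literature.MathematicalPhysics.QuantumFieldTheory.Balaban1983to89.B5Projector144

/-! # `Balaban1983to89.B5GaussSectCR144` — the Gaussian formulas of B5 Sect. C with the PRINTED projection
operator R of (1.44) / (1.38) and under the printed inputs only (closes item (a) «NOT CERTIFIED» of
`B5GaussSectC`, GAPS C-b05g13-3; unit b2b-balaban-b05-g13, node 4)

CITATION HEADER. T. Bałaban, *Propagators and renormalization transformations for lattice gauge theories. I*,
Commun. Math. Phys. 95 (1984) 17–40 [`Balaban1984PropagatorsI`], Sect. C "Change of gauge", pp. 22–26 [PDF 6–10].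
Cell pub-balaban, paper sub-cell B05. This leaf JOINS two tree modules and transcribes nothing new: the Gaussian
integrals of `B5GaussSectC` (b05 node 3: (1.24), (1.27)/(1.28) = (1.39), p. 25 l. 1, (1.40), (1.41), (1.46), with R
typed as the orthogonal projection onto ΔN(Q′_k)) and the operator algebra of `B5Projector144` (reader A: the
printed operators (1.38) `R138`, (1.44) `R144`, the minimiser (1.43) `lambda0`, over the printed-input bundles
`LapData` / `AvgData` / `GreenData`). The quotations below are those two modules' transcriptions (renders
`…/1984-cmp95-propagators-rt-I-p006-x2.png`, `-p008-x2.png`, `-p009-x2.png` read as images there and by this unit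
for node 3).

WHAT IS PRINTED.  p. 24 [PDF 8]: «Let us denote the projection operator by R, so we have
R = I − Δ⁻¹Q′_k*(Q′_kΔ⁻²Q′_k*)⁻¹Q′_kΔ⁻¹. (1.38)» (parenthesis restored, G-B5-14 (i)) and «𝒢_α(∂*A) =
(∫dλδ(Q′_kλ)exp(−(1/2α)‖Δλ‖²))⁻¹ exp(−(1/2α)‖R∂*A‖²), (1.39)».  p. 25 [PDF 9] ll. 1–5: «The projection operator
R has a clear meaning. It is an orthogonal projection on the linear subspace ΔN(Q′_k) of L²(T_η),
N(Q′_k) = {λ : Q′_kλ = 0}. … Let us denote this subspace by R also, R = ΔN(Q′_k).»; «we get the following formulas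
for the minimizing function λ₀,  λ₀ = G′_k∂*A − G′_k²Q′_k*(Q′_kG′_k²Q′_k*)⁻¹Q′_kG′_k∂*A, (1.43)  and for the
projection operator R   R = I − G′_kQ′_k*(Q′_kG′_k²Q′_k*)⁻¹Q′_kG′_k. (1.44)»; «Let us recall also that the operator
Δ is positive definite on N(Q′_k), thus invertible, as it follows from [2].»

TYPING.  As in `B5Projector144`: abstract real inner-product spaces `E` (= L²(T_η), scalar functions) and `F` (=
functions on the unit lattice), `one : E`, `one' : F` the constants 1, `Δ Δi : E →ₗ[ℝ] E` (Δ and the p. 22 inverse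
Δ⁻¹), `q : E →ₗ[ℝ] F` = Q′_k, `qs` = Q′_k*, `ci` = (Q′_kΔ⁻²Q′_k*)⁻¹ (through `hci`), `g` = G′_k, `c₂` =
(Q′_kG′_k²Q′_k*)⁻¹, `a` the parameter of Δ′_a; the printed inputs are the HYPOTHESIS BUNDLES `LapData one Δ Δi`,
`AvgData one one' q qs`, `GreenData Δ q qs a g c₂` of that module (field by field the sentences of p. 22 / p. 25;
existence of the inverses is the paper's, G-B5-13, not re-proved).  As in `B5GaussSectC`: N(Q′_k) is the submodule
`LinearMap.ker q`, the subspace R is `Rsub (ker q) Δ = ΔN(Q′_k)`, the operator of the p. 25 sentence is `Rop (ker q)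
Δ` (orthogonal projection onto ΔN(Q′_k), `E` finite-dimensional), `δ(Q′_kλ)dλ` is Lebesgue measure on `↥(ker q)`,
|det(Δ↾_{N(Q′_k)})| = `detN`, 𝒢_α = `calG`, δ_R-side `deltaK`.

WHAT THIS FILE CERTIFIES (kernel, no `sorry`; value = the last free convention of C-b05g13-3 discharged — every
Sect. C Gaussian identity of `B5GaussSectC` now holds with the PRINTED R and from reader A's printed-input bundles
alone; NOT summit progress).
1. `injOn_ker`: the one hypothesis of `B5GaussSectC` §§2–6, `Set.InjOn Δ N(Q′_k)` («Δ positive definite on N(Q′_k),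
   thus invertible» in the form used), is a CONSEQUENCE of `LapData` + `AvgData` (+ 1 ≠ 0): Δλ = 0 ⟹ λ = π₁λ (p. 22:
   Δ⁻¹Δ = I − π₁) and N(Q′_k) ⊥ 1 (`AvgData.inner_one_of_ker`), so λ = 0.
2. `Rop_eq_R144` (**the p. 25 sentence = the formula (1.44)**): under `GreenData` + Δ symmetric + Q′_k* adjoint, the
   orthogonal projection onto ΔN(Q′_k) equals `R144` on EVERY f ∈ L²(T_η) (`R144` is a symmetric idempotent —
   `R144_symm`, `R144_idem` — whose range is ΔN(Q′_k): `R144_mem_Rsub`, `range_R144`; then Mathlib's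
   `Submodule.eq_starProjection_of_mem_of_inner_eq_zero`); `coe_Rop_eq_R144` as operators.  `Rop_eq_R138_of_orth`,
   `Rop_Delta_eq_R138`: = the formula (1.38) on f ⊥ 1, in particular on every Δλ / ∂*A-type field (via
   `B5Projector144.R138_eq_R144_of_orth`; on constants (1.38) differs, G-adv4-11 (ii), not load-bearing).
3. (1.26)/(1.43): `lambda0_mem_ker`, `Delta_lambda0` — the printed minimiser λ₀ satisfies Q′_kλ₀ = 0 and
   Δλ₀ = R∂*A, i.e. it is a witness of `B5GaussSectC.exists_lambda0`; `iInf_124_R144`: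
   inf_{Q′_kλ=0} ‖∂*A − Δλ‖² = ‖(I − R)∂*A‖² with I − R = `P144` = G′_kQ′_k*(Q′_kG′_k²Q′_k*)⁻¹Q′_kG′_k.
4. The integrals with the printed R: `calG_eq_R144` ((1.39) verbatim with R = (1.44)), `calG_eq_R138` ((1.39) with
   (1.38) on f ⊥ 1), `calG_eq_127_printed` ((1.27) = (1.28) = (1.39)), `integral_124_P144` ((1.24) evaluated:
   Z_N(α)·exp(−‖(I − R)∂*A‖²/2α)), `integral_calG_sub_Delta_printed` (p. 25 l. 1), `integral_146_R144` ((1.46), every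
   regularisation φ of δ_R), `tendsto_integral_calG_printed` ((1.41): ∫𝒢_α f → |det(Δ↾N(Q′_k))|·∫_{R^⊥} f) and
   `deltaK_range_R144` (the subspace R of δ_R is the range of (1.44)) — all with NO hypothesis besides the bundles.

NOT CERTIFIED HERE: the instantiation of `LapData`/`AvgData`/`GreenData` by the torus operators of the b05 chain
(`B5Action121.LapS`, `B5Block118.QsOp`, …) — `B5GaussSectC` §7 discharges `Set.InjOn` on the torus directly
(`injOn_torus`) and `B5Projector144.hypotheses_satisfiable` records joint satisfiability; items (b)–(d) of
`B5GaussSectC`'s list (Jacobian constant of δ(Q′_kλ)dλ, (1.42)/(1.45), the dA side) are unchanged.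

TAGS: [cite: Balaban1984PropagatorsI, …] on the statements matching a printed formula; [folklore] on
linear-algebra glue. -/

noncomputable section

open MeasureTheory Module Filter Topology
open scoped InnerProductSpace

open Literature.MathematicalPhysics.QuantumFieldTheory.Balaban1983to89.B5GaussSectC
open Literature.MathematicalPhysics.QuantumFieldTheory.Balaban1983to89.B5Projector144

namespace Literature.MathematicalPhysics.QuantumFieldTheory.Balaban1983to89.B5GaussSectCR144

variable {E F : Type*} [NormedAddCommGroup E] [InnerProductSpace ℝ E] [NormedAddCommGroup F]
  [InnerProductSpace ℝ F]
variable {one : E} {one' : F} {Δ Δi : E →ₗ[ℝ] E} {q : E →ₗ[ℝ] F} {qs : F →ₗ[ℝ] E} {ci : F →ₗ[ℝ] F}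
  {a : ℝ} {g : E →ₗ[ℝ] E} {c₂ : F →ₗ[ℝ] F}

/-! ## §1 The subspace R = ΔN(Q′_k), the Sect. C hypothesis, and R(1.44) on it (no dimension hypothesis) -/

/-- `R = ΔN(Q′_k)`, `N(Q′_k) = {λ : Q′_kλ = 0}` = `ker Q′_k`: membership in `B5GaussSectC.Rsub (ker Q′_k) Δ` is
`∃ λ, Q′_kλ = 0 ∧ ω = Δλ` — the right-hand side of `B5Projector144.R144_fix_iff_exists`.
[cite: Balaban1984PropagatorsI, p.25 ll.2-5] -/
theorem mem_Rsub_ker (Δ : E →ₗ[ℝ] E) (q : E →ₗ[ℝ] F) {ω : E} :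
    ω ∈ Rsub (LinearMap.ker q) Δ ↔ ∃ l : E, q l = 0 ∧ ω = Δ l := by
  rw [mem_Rsub]
  constructor
  · rintro ⟨l, hl, rfl⟩
    exact ⟨l, LinearMap.mem_ker.mp hl, rfl⟩
  · rintro ⟨l, hl, rfl⟩
    exact ⟨l, LinearMap.mem_ker.mpr hl, rfl⟩

/-- The same subspace as a pushforward: `Rsub (ker Q′_k) Δ = (ker Q′_k).map Δ` (the object b09's `B9Eq325Proj.lapKer`
names for B9 (3.21); by name, not imported). [folklore] -/
theorem Rsub_ker_eq_map (Δ : E →ₗ[ℝ] E) (q : E →ₗ[ℝ] F) :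
    Rsub (LinearMap.ker q) Δ = (LinearMap.ker q).map Δ := by
  ext ω
  rw [mem_Rsub, Submodule.mem_map]

/-- THE SECT. C HYPOTHESIS FROM THE PRINTED INPUTS. «the operator Δ is positive definite on N(Q′_k), thus
invertible» in the form `B5GaussSectC` uses (`Set.InjOn Δ N(Q′_k)`: Q′_kλ = 0 ∧ Δλ = 0 ⟹ λ = 0) follows from
`LapData` (p. 22: Δ⁻¹Δ = I − π₁, so Δλ = 0 forces λ = π₁λ ∈ ℝ·1) and `AvgData` (N(Q′_k) ⊥ 1, from Q′_k1 = 1 ≠ 0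
and «similarly for the orthogonal subspaces»). [cite: Balaban1984PropagatorsI, p.25] -/
theorem injOn_ker (hΔ : LapData one Δ Δi) (hQ : AvgData one one' q qs) (hone : one ≠ 0)
    (hone' : one' ≠ 0) : Set.InjOn Δ (LinearMap.ker q) := by
  rw [injOn_iff]
  intro l hl hl0
  have h1 : l - proj1 one l = 0 := by rw [← hΔ.inv_lap l, hl0, map_zero]
  have h2 : proj1 one l = 0 :=
    proj1_eq_zero_of_inner _ _ (hQ.inner_one_of_ker hone hone' l (LinearMap.mem_ker.mp hl))
  rwa [h2, sub_zero] at h1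

/-- R∂*A ∈ ΔN(Q′_k) for the printed (1.44): `R144 f ∈ Rsub (ker Q′_k) Δ` (from `R144_idem` and
`R144_fix_iff_exists`). [folklore] -/
theorem R144_mem_Rsub (hG : GreenData Δ q qs a g c₂) (f : E) :
    R144 q qs g c₂ f ∈ Rsub (LinearMap.ker q) Δ :=
  (mem_Rsub_ker Δ q).mpr ((R144_fix_iff_exists hG _).mp (R144_idem hG f))

/-- «R = ΔN(Q′_k)» for (1.44) as an identity of subspaces: the range of `R144` IS `Rsub (ker Q′_k) Δ`.
[cite: Balaban1984PropagatorsI, p.25 ll.2-5] -/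
theorem range_R144 (hG : GreenData Δ q qs a g c₂) :
    LinearMap.range (R144 q qs g c₂) = Rsub (LinearMap.ker q) Δ := by
  apply le_antisymm
  · rintro ω ⟨f, rfl⟩
    exact R144_mem_Rsub hG f
  · intro ω hω
    obtain ⟨l, hl, rfl⟩ := (mem_Rsub_ker Δ q).mp hω
    exact ⟨Δ l, R144_lap hG l hl⟩

/-- ∂*A − R∂*A ⊥ ΔN(Q′_k) for the printed (1.44) (R symmetric, idempotent, fixing ΔN(Q′_k)). [folklore] -/
theorem inner_sub_R144 (hG : GreenData Δ q qs a g c₂) (hΔs : ∀ x y : E, inner ℝ (Δ x) y = inner ℝ x (Δ y))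
    (hadj : ∀ (x : E) (φ : F), inner ℝ (q x) φ = inner ℝ x (qs φ)) (f ω : E)
    (hω : ω ∈ Rsub (LinearMap.ker q) Δ) : inner ℝ (f - R144 q qs g c₂ f) ω = 0 := by
  obtain ⟨l, hl, rfl⟩ := (mem_Rsub_ker Δ q).mp hω
  rw [← R144_lap hG l hl, ← R144_symm hG hΔs hadj, map_sub, R144_idem hG, sub_self, inner_zero_left]

/-- (1.43): Q′_kλ₀ = 0 — the printed minimiser lies in N(Q′_k) (`B5Projector144.q_lambda0`). [folklore] -/
theorem lambda0_mem_ker (hG : GreenData Δ q qs a g c₂) (f : E) :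
    lambda0 q qs g c₂ f ∈ LinearMap.ker q :=
  LinearMap.mem_ker.mpr (q_lambda0 hG f)

/-! ## §2 The p. 25 sentence IS the formula: `Rop (ker Q′_k) Δ = R144` (and = `R138` on 1^⊥) -/

section FinDim

variable [FiniteDimensional ℝ E]

/-- **«It is an orthogonal projection on the linear subspace ΔN(Q′_k)» = (1.44).** Under the printed inputs
(`GreenData`: G′_k = (Δ + aQ′_k*Q′_k)⁻¹, (Q′_kG′_k²Q′_k*)⁻¹; Δ symmetric; Q′_k* adjoint to Q′_k) the orthogonal
projection of L²(T_η) onto ΔN(Q′_k) — `B5GaussSectC.Rop` — equals R = I − G′_kQ′_k*(Q′_kG′_k²Q′_k*)⁻¹Q′_kG′_k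
on every f. [cite: Balaban1984PropagatorsI, (1.44)+p.25 ll.2-5] -/
theorem Rop_eq_R144 (hG : GreenData Δ q qs a g c₂) (hΔs : ∀ x y : E, inner ℝ (Δ x) y = inner ℝ x (Δ y))
    (hadj : ∀ (x : E) (φ : F), inner ℝ (q x) φ = inner ℝ x (qs φ)) (f : E) :
    Rop (LinearMap.ker q) Δ f = R144 q qs g c₂ f := by
  rw [Rop]
  exact Submodule.eq_starProjection_of_mem_of_inner_eq_zero (R144_mem_Rsub hG f)
    (fun w hw => inner_sub_R144 hG hΔs hadj f w hw)

/-- `Rop_eq_R144` as an identity of linear operators on L²(T_η).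
[cite: Balaban1984PropagatorsI, (1.44)+p.25 ll.2-5] -/
theorem coe_Rop_eq_R144 (hG : GreenData Δ q qs a g c₂) (hΔs : ∀ x y : E, inner ℝ (Δ x) y = inner ℝ x (Δ y))
    (hadj : ∀ (x : E) (φ : F), inner ℝ (q x) φ = inner ℝ x (qs φ)) :
    ((Rop (LinearMap.ker q) Δ : E →L[ℝ] E) : E →ₗ[ℝ] E) = R144 q qs g c₂ :=
  LinearMap.ext fun f => Rop_eq_R144 hG hΔs hadj f

/-- … and = the operator (1.38) (p. 22 convention Δ⁻¹1 = 0) on fields orthogonal to the constants — the only ones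
R is ever applied to (`B5Projector144.R138_eq_R144_of_orth`; on constants (1.38) projects onto ΔN(Q′_k) ⊕ ℝ·1,
G-adv4-11 (ii)). [cite: Balaban1984PropagatorsI, (1.38)+p.25 ll.2-5] -/
theorem Rop_eq_R138_of_orth (hΔ : LapData one Δ Δi) (hQ : AvgData one one' q qs) (hone : one ≠ 0)
    (hone' : one' ≠ 0) (hci : ∀ φ : F, inner ℝ one' φ = 0 → q (Δi (Δi (qs (ci φ)))) = φ)
    (hG : GreenData Δ q qs a g c₂) (f : E) (hf : inner ℝ one f = 0) :
    Rop (LinearMap.ker q) Δ f = R138 Δi q qs ci f := by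
  rw [Rop_eq_R144 hG hΔ.symm hQ.adj f, R138_eq_R144_of_orth hΔ hQ hone hone' hci hG f hf]

/-- In particular on Δλ (∂*A-type arguments): RΔλ computed by (1.38) is the orthogonal projection. [folklore] -/
theorem Rop_Delta_eq_R138 (hΔ : LapData one Δ Δi) (hQ : AvgData one one' q qs) (hone : one ≠ 0)
    (hone' : one' ≠ 0) (hci : ∀ φ : F, inner ℝ one' φ = 0 → q (Δi (Δi (qs (ci φ)))) = φ)
    (hG : GreenData Δ q qs a g c₂) (l : E) :
    Rop (LinearMap.ker q) Δ (Δ l) = R138 Δi q qs ci (Δ l) :=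
  Rop_eq_R138_of_orth hΔ hQ hone hone' hci hG _ (hΔ.inner_one_lap l)

/-- (1.26)/(1.43): Δλ₀ = R∂*A for the PRINTED λ₀ — together with `lambda0_mem_ker` the printed minimiser is a
witness of `B5GaussSectC.exists_lambda0` (the infimum in (1.24) is attained at λ₀).
[cite: Balaban1984PropagatorsI, (1.43) p.25] -/
theorem Delta_lambda0 (hG : GreenData Δ q qs a g c₂) (hΔs : ∀ x y : E, inner ℝ (Δ x) y = inner ℝ x (Δ y))
    (hadj : ∀ (x : E) (φ : F), inner ℝ (q x) φ = inner ℝ x (qs φ)) (f : E) :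
    Δ (lambda0 q qs g c₂ f) = Rop (LinearMap.ker q) Δ f := by
  rw [Rop_eq_R144 hG hΔs hadj f]
  exact lap_lambda0 hG f

/-- (1.24)/(1.26) with the printed R: inf_{λ : Q′_kλ = 0} ‖∂*A − Δλ‖² = ‖(I − R)∂*A‖², I − R = `P144` =
G′_kQ′_k*(Q′_kG′_k²Q′_k*)⁻¹Q′_kG′_k («the quadratic form in ∂*A is defined by a projection operator», p. 22).
[cite: Balaban1984PropagatorsI, (1.24)/(1.26) pp.21-22] -/
theorem iInf_124_R144 (hG : GreenData Δ q qs a g c₂) (hΔs : ∀ x y : E, inner ℝ (Δ x) y = inner ℝ x (Δ y))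
    (hadj : ∀ (x : E) (φ : F), inner ℝ (q x) φ = inner ℝ x (qs φ)) (f : E) :
    ⨅ x : LinearMap.ker q, ‖f - Δ (x : E)‖ ^ 2 = ‖P144 q qs g c₂ f‖ ^ 2 := by
  rw [iInf_124 (LinearMap.ker q) Δ f, Rop_eq_R144 hG hΔs hadj f, R144_apply, sub_sub_cancel]

end FinDim

/-! ## §3 The Gaussian integrals of Sect. C with the printed R, under the printed inputs only -/

section Integrals

variable [FiniteDimensional ℝ E] [MeasurableSpace E] [BorelSpace E]

/-- **(1.39) verbatim with R = (1.44)**: 𝒢_α(∂*A) = (∫dλδ(Q′_kλ)exp(−‖Δλ‖²/2α))⁻¹·exp(−‖R∂*A‖²/2α),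
R = I − G′_kQ′_k*(Q′_kG′_k²Q′_k*)⁻¹Q′_kG′_k. [cite: Balaban1984PropagatorsI, (1.39) p.24 + (1.44) p.25] -/
theorem calG_eq_R144 (hG : GreenData Δ q qs a g c₂) (hΔs : ∀ x y : E, inner ℝ (Δ x) y = inner ℝ x (Δ y))
    (hadj : ∀ (x : E) (φ : F), inner ℝ (q x) φ = inner ℝ x (qs φ)) (α : ℝ) (f : E) :
    calG (LinearMap.ker q) Δ α f = (ZN (LinearMap.ker q) Δ α)⁻¹ * gaussW E α (R144 q qs g c₂ f) := by
  rw [calG, Rop_eq_R144 hG hΔs hadj f]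

/-- (1.39) with R = (1.38) on ∂*A-type arguments (f ⊥ 1).
[cite: Balaban1984PropagatorsI, (1.39) p.24 + (1.38) p.24] -/
theorem calG_eq_R138 (hΔ : LapData one Δ Δi) (hQ : AvgData one one' q qs) (hone : one ≠ 0)
    (hone' : one' ≠ 0) (hci : ∀ φ : F, inner ℝ one' φ = 0 → q (Δi (Δi (qs (ci φ)))) = φ)
    (hG : GreenData Δ q qs a g c₂) (α : ℝ) (f : E) (hf : inner ℝ one f = 0) :
    calG (LinearMap.ker q) Δ α f = (ZN (LinearMap.ker q) Δ α)⁻¹ * gaussW E α (R138 Δi q qs ci f) := by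
  rw [calG, Rop_eq_R138_of_orth hΔ hQ hone hone' hci hG f hf]

/-- **(1.27) = (1.28) = (1.39) from the printed inputs alone**:
exp(−‖∂*A‖²/2α)·(∫_{N(Q′_k)}exp(−‖∂*A − Δλ‖²/2α)dλ)⁻¹ = (∫_{N(Q′_k)}exp(−‖Δλ‖²/2α)dλ)⁻¹·exp(−‖R∂*A‖²/2α)
with R = (1.44) (α > 0; `Set.InjOn` supplied by `injOn_ker`).
[cite: Balaban1984PropagatorsI, (1.27)-(1.28) p.22 + (1.39) p.24] -/
theorem calG_eq_127_printed (hΔ : LapData one Δ Δi) (hQ : AvgData one one' q qs) (hone : one ≠ 0)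
    (hone' : one' ≠ 0) (hG : GreenData Δ q qs a g c₂) {α : ℝ} (hα : 0 < α) (f : E) :
    gaussW E α f * (∫ x : LinearMap.ker q, gaussW E α (f - Δ (x : E)))⁻¹ =
      (ZN (LinearMap.ker q) Δ α)⁻¹ * gaussW E α (R144 q qs g c₂ f) := by
  rw [calG_eq_127 (injOn_ker hΔ hQ hone hone') hα f, calG_eq_R144 hG hΔ.symm hQ.adj α f]

/-- (1.24) evaluated with the printed I − R: ∫_{N(Q′_k)}exp(−‖∂*A − Δλ‖²/2α)dλ = Z_N(α)·exp(−‖(I − R)∂*A‖²/2α),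
(I − R)∂*A = G′_kQ′_k*(Q′_kG′_k²Q′_k*)⁻¹Q′_kG′_k∂*A. [cite: Balaban1984PropagatorsI, (1.24) p.21 + (1.44) p.25] -/
theorem integral_124_P144 (hG : GreenData Δ q qs a g c₂) (hΔs : ∀ x y : E, inner ℝ (Δ x) y = inner ℝ x (Δ y))
    (hadj : ∀ (x : E) (φ : F), inner ℝ (q x) φ = inner ℝ x (qs φ)) (α : ℝ) (f : E) :
    ∫ x : LinearMap.ker q, gaussW E α (f - Δ (x : E)) =
      ZN (LinearMap.ker q) Δ α * gaussW E α (P144 q qs g c₂ f) := by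
  rw [integral_124, Rop_eq_R144 hG hΔs hadj f, R144_apply, sub_sub_cancel]

/-- p. 25 l. 1 «∫dλδ(Q′_kλ)𝒢_α(∂*A^λ) = 1» from the printed inputs alone (every ∂*A, α > 0).
[cite: Balaban1984PropagatorsI, p.25 l.1] -/
theorem integral_calG_sub_Delta_printed (hΔ : LapData one Δ Δi) (hQ : AvgData one one' q qs)
    (hone : one ≠ 0) (hone' : one' ≠ 0) {α : ℝ} (hα : 0 < α) (f : E) :
    ∫ x : LinearMap.ker q, calG (LinearMap.ker q) Δ α (f - Δ (x : E)) = 1 :=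
  integral_calG_sub_Delta (injOn_ker hΔ hQ hone hone') hα f

/-- **(1.46) with the printed R = (1.44), from the printed inputs alone**, for EVERY function φ in place of δ_R:
∫_{N(Q′_k)} |det(Δ↾_{N(Q′_k)})| φ(R(∂*A − Δλ)) dλ = ∫_R φ.
[cite: Balaban1984PropagatorsI, (1.46) p.26 + (1.44) p.25] -/
theorem integral_146_R144 (hΔ : LapData one Δ Δi) (hQ : AvgData one one' q qs) (hone : one ≠ 0)
    (hone' : one' ≠ 0) (hG : GreenData Δ q qs a g c₂) {G : Type*} [NormedAddCommGroup G] [NormedSpace ℝ G]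
    (φ : E → G) (f : E) :
    ∫ x : LinearMap.ker q, detN (LinearMap.ker q) Δ • φ (R144 q qs g c₂ (f - Δ (x : E))) =
      ∫ y : Rsub (LinearMap.ker q) Δ, φ y := by
  have h := integral_146 (injOn_ker hΔ hQ hone hone') φ f
  simp_rw [Rop_eq_R144 hG hΔ.symm hQ.adj] at h
  exact h

/-- **(1.41) from the printed inputs alone**: for every f ∈ C_c(L²(T_η)),
∫𝒢_α(λ)f(λ)dλ → |det(Δ↾_{N(Q′_k)})|·∫_{R^⊥} f as α → 0⁺ (R = ΔN(Q′_k); the δ_R display's λ₂ ranges over R^⊥,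
G-adv4-10). [cite: Balaban1984PropagatorsI, (1.41) p.25] -/
theorem tendsto_integral_calG_printed (hΔ : LapData one Δ Δi) (hQ : AvgData one one' q qs) (hone : one ≠ 0)
    (hone' : one' ≠ 0) (f : E → ℝ) (hf : Continuous f) (hsupp : HasCompactSupport f) :
    Tendsto (fun α => ∫ v, calG (LinearMap.ker q) Δ α v * f v) (𝓝[>] 0)
      (𝓝 (detN (LinearMap.ker q) Δ * B5GaussSectC.deltaK (Rsub (LinearMap.ker q) Δ) f)) :=
  tendsto_integral_calG (injOn_ker hΔ hQ hone hone') f hf hsupp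

/-- The subspace R of δ_R «concentrated at the origin of the sub-space R» is the range of the printed operator
(1.44): ∫_{R^⊥} over `(range R144)^⊥` = over `(ΔN(Q′_k))^⊥`.
[cite: Balaban1984PropagatorsI, (1.41) p.25 + (1.44) p.25] -/
theorem deltaK_range_R144 (hG : GreenData Δ q qs a g c₂) (f : E → ℝ) :
    B5GaussSectC.deltaK (LinearMap.range (R144 q qs g c₂)) f =
      B5GaussSectC.deltaK (Rsub (LinearMap.ker q) Δ) f := by
  rw [range_R144 hG]

end Integrals

end Literature.MathematicalPhysics.QuantumFieldTheory.Balaban1983to89.B5GaussSectCR144
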